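import Summits.KontsevichZagierPeriods.KontsevichZagierPeriods.Theses.HurwitzMicroSectors
import Summits.KontsevichZagierPeriods.KontsevichZagierPeriods.Theorems.HurwitzMicroSectorsNormalFormPrinciplePiBoxTransfer
import Summits.KontsevichZagierPeriods.KontsevichZagierPeriods.Theorems.HurwitzMicroSectorsNormalFormPrincipleVariants2262

/-! TTRL-lite variant V2264 of stmt-KontsevichZagierPeriods-3869

Variant V2264 = `stub_boxRigidity` (the leaf `BoxRigidity` of `NormalFormPrinciple`: two representations
on open unit boxes with integrands of KZ's rational shape `p/q` over `ℚ` and equal values are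
KZ-equivalent) under the two-sided move `bound_nat:m≤3; bound_nat:m'≤8` (left dimension `≤ 3`, right
dimension `≤ 8`; note the hypothesis order `m' ≤ 8 → m ≤ 3 → …` of the generated statement). Verdict of
the attempt seat: **open** — this file is the exact-strength certificate, not a proof of the variant.
A two-sided bound has the strength of `BoxVanishing` of the LARGEST dimension allowed, here `8`
(`BoxVanishing K` := every box-rational representation on `(0,1)ᴷ` of value `0` is a relation):
* `stub_boxRigidity_var2264_iff_boxVanishing_eight`: V2264 ⟺ **BoxVanishing 8** ((⇒) the pair `(0, 8)`
  is allowed — compare with the zero representation on the `0`-box, `boxVanishingDim_right_of_pair`;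
  (⇐) pad both sides to the `8`-box and subtract there, `boxRigidityLe_of_boxVanishingDim 8`);
* `stub_boxRigidity_var2264_iff_var2262` / `_iff_var2232`: V2264 is literally the frozen siblings
  V2262 `(3, 8)` and V2232 `(2, 8)` (files `…Variants2262/2232`) — bounding instead of freezing and the
  whole left slot `m ≤ 3` are idle;
* `stub_boxRigidity_var2264_iff_le_eight`: V2264 ⟺ BoxRigidity for ALL `m, m' ≤ 8` — Conjecture 1 of
  Kontsevich–Zagier for every pair of rational integrands on the boxes `(0,1)^{≤ 8}`;
* `boxVanishing_le_eight_of_stub_boxRigidity_var2264`: V2264 gives `BoxVanishing j` for every `j ≤ 8`;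
  already `j = 2` contains "`a + b·G = 0 ⇒ [a + b/(1+x²y²)]_{(0,1)²}` is a relation" (`G` Catalan's
  constant) and `j = 5` contains "`ζ(5) = r ∈ ℚ ⇒ [1/(1 − x₁⋯x₅) − r]_{(0,1)⁵}` is a relation" — decided
  today by no theorem (irrationality open, no chain of the four moves known). This is the residual goal;
* `stub_boxRigidity_var2264_of_parent` / `_of_statement`: parent leaf ⇒ V2264 and
  `KontsevichZagierPeriods ⇒ V2264`, so a refutation of the variant would refute Conjecture 1 for the
  tree's calculus (`relations` is the closure of the four moves and the tree has no invariant of it finer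
  than `eval`) — the variant is neither provable nor refutable from the tree today.
(`BoxVanishing ≤ 1` is the theorem `boxRigidity_of_le_one`, Baker; dimension `2` is the first open rung.)
Source: M. Kontsevich, D. Zagier, *Periods* (2001), §1.2 Conjecture 1. Pure proof file, no definitions. -/

-- `Summit.<Summit>.<Problem>` is the tree's mandated summit-side namespace (CONVENTIONS §2); for this
-- single-conjunct summit the two coincide, so the duplicate is deliberate.
set_option linter.dupNamespace false

noncomputable section

namespace Summit.KontsevichZagierPeriods.KontsevichZagierPeriods.Theorems

open MeasureTheory Set
open Literature.NumberTheory.Transcendental Literature.NumberTheory.Transcendental.KZ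
open Summit.KontsevichZagierPeriods.KontsevichZagierPeriods.Theses.HurwitzMicroSectors
open Summit.KontsevichZagierPeriods.HurwitzMicroSectors.NormalFormPrinciple.PiBox

/-! ## The variant V2264 itself: exactly `BoxVanishing 8` -/

/-- **V2264 ⟺ `BoxVanishing 8`**: (⇒) the pair of dimensions `(0, 8)` is allowed (`8 ≤ 8`, `0 ≤ 3`),
so compare a vanishing box-rational representation on `(0,1)⁸` with the zero representation on the
`0`-box (`boxVanishingDim_right_of_pair 0 8`); (⇐) pad both representations to the `8`-box and subtract
there (`boxRigidityLe_of_boxVanishingDim 8`, `m ≤ 3 ≤ 8`, `m' ≤ 8`).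
[cite: KontsevichZagier2001, §1.2 Conjecture 1] -/
theorem stub_boxRigidity_var2264_iff_boxVanishing_eight :
    (∀ (m m' : ℕ) (N : IntegralRep m) (N' : IntegralRep m'), m' ≤ 8 → m ≤ 3 → N.domain = {x | ∀ i, x i ∈ Set.Ioo (0:ℝ) 1} → N.IsRational → N'.domain = {x | ∀ i, x i ∈ Set.Ioo (0:ℝ) 1} → N'.IsRational → N.value = N'.value → Equivalent N N') ↔
    (∀ (M : IntegralRep 8), M.domain = {x | ∀ i, x i ∈ Set.Ioo (0:ℝ) 1} → M.IsRational →
      M.value = 0 → of M ∈ relations) :=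
  ⟨fun h => boxVanishingDim_right_of_pair 0 8 fun N N' => h 0 8 N N' le_rfl (Nat.zero_le 3),
    fun hvan m m' N N' hm' hm =>
      boxRigidityLe_of_boxVanishingDim 8 hvan m m' N N' (hm.trans (by norm_num)) hm'⟩

/-- **V2264 ⟺ the frozen sibling V2262** (`fix_nat:m=3; fix_nat:m'=8`): both are `BoxVanishing 8`.
[cite: KontsevichZagier2001, §1.2 Conjecture 1] -/
theorem stub_boxRigidity_var2264_iff_var2262 :
    (∀ (m m' : ℕ) (N : IntegralRep m) (N' : IntegralRep m'), m' ≤ 8 → m ≤ 3 → N.domain = {x | ∀ i, x i ∈ Set.Ioo (0:ℝ) 1} → N.IsRational → N'.domain = {x | ∀ i, x i ∈ Set.Ioo (0:ℝ) 1} → N'.IsRational → N.value = N'.value → Equivalent N N') ↔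
    (∀ (N : IntegralRep 3) (N' : IntegralRep 8), N.domain = {x | ∀ i, x i ∈ Set.Ioo (0:ℝ) 1} → N.IsRational → N'.domain = {x | ∀ i, x i ∈ Set.Ioo (0:ℝ) 1} → N'.IsRational → N.value = N'.value → Equivalent N N') := by
  rw [stub_boxRigidity_var2264_iff_boxVanishing_eight, stub_boxRigidity_var2262_iff_boxVanishing_eight]

/-- **V2264 ⟺ the frozen sibling V2232** (`fix_nat:m=2; fix_nat:m'=8`): both are `BoxVanishing 8`.
[cite: KontsevichZagier2001, §1.2 Conjecture 1] -/
theorem stub_boxRigidity_var2264_iff_var2232 :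
    (∀ (m m' : ℕ) (N : IntegralRep m) (N' : IntegralRep m'), m' ≤ 8 → m ≤ 3 → N.domain = {x | ∀ i, x i ∈ Set.Ioo (0:ℝ) 1} → N.IsRational → N'.domain = {x | ∀ i, x i ∈ Set.Ioo (0:ℝ) 1} → N'.IsRational → N.value = N'.value → Equivalent N N') ↔
    (∀ (N : IntegralRep 2) (N' : IntegralRep 8), N.domain = {x | ∀ i, x i ∈ Set.Ioo (0:ℝ) 1} → N.IsRational → N'.domain = {x | ∀ i, x i ∈ Set.Ioo (0:ℝ) 1} → N'.IsRational → N.value = N'.value → Equivalent N N') := by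
  rw [stub_boxRigidity_var2264_iff_boxVanishing_eight, stub_boxRigidity_var2232_iff_boxVanishing_eight]

/-- **V2264 ⟺ `BoxRigidity` for all `m, m' ≤ 8`** (the honest strength of the variant: Conjecture 1 for
all pairs of rational integrands on the open unit boxes of dimension at most `8`; the bound `m ≤ 3` may
be relaxed to `m ≤ 8` at no cost). [cite: KontsevichZagier2001, §1.2 Conjecture 1] -/
theorem stub_boxRigidity_var2264_iff_le_eight :
    (∀ (m m' : ℕ) (N : IntegralRep m) (N' : IntegralRep m'), m' ≤ 8 → m ≤ 3 → N.domain = {x | ∀ i, x i ∈ Set.Ioo (0:ℝ) 1} → N.IsRational → N'.domain = {x | ∀ i, x i ∈ Set.Ioo (0:ℝ) 1} → N'.IsRational → N.value = N'.value → Equivalent N N') ↔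
    (∀ (m m' : ℕ) (N : IntegralRep m) (N' : IntegralRep m'), m ≤ 8 → m' ≤ 8 →
      N.domain = {x | ∀ i, x i ∈ Set.Ioo (0:ℝ) 1} → N.IsRational →
      N'.domain = {x | ∀ i, x i ∈ Set.Ioo (0:ℝ) 1} → N'.IsRational →
      N.value = N'.value → Equivalent N N') := by
  rw [stub_boxRigidity_var2264_iff_boxVanishing_eight]
  exact ⟨fun hvan => boxRigidityLe_of_boxVanishingDim 8 hvan,
    fun h => boxVanishingDim_left_of_pair 8 8 fun N N' => h 8 8 N N' le_rfl le_rfl⟩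

/-- **V2264 ⇒ `BoxVanishing` in every dimension `j ≤ 8`** (monotonicity by padding,
`boxVanishingDim_mono`): in particular the square (`j = 2`, Catalan's dichotomy) and `j = 5` (`ζ(5)`'s).
[cite: KontsevichZagier2001, §1.2 Conjecture 1] -/
theorem boxVanishing_le_eight_of_stub_boxRigidity_var2264
    (h : ∀ (m m' : ℕ) (N : IntegralRep m) (N' : IntegralRep m'), m' ≤ 8 → m ≤ 3 → N.domain = {x | ∀ i, x i ∈ Set.Ioo (0:ℝ) 1} → N.IsRational → N'.domain = {x | ∀ i, x i ∈ Set.Ioo (0:ℝ) 1} → N'.IsRational → N.value = N'.value → Equivalent N N')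
    {j : ℕ} (hj : j ≤ 8) (N : IntegralRep j) (hNd : N.domain = {x | ∀ i, x i ∈ Set.Ioo (0:ℝ) 1})
    (hNr : N.IsRational) (hv : N.value = 0) : of N ∈ relations :=
  boxVanishingDim_mono hj (stub_boxRigidity_var2264_iff_boxVanishing_eight.1 h) N hNd hNr hv

/-! ## V2264 follows from the parent leaf and from the Summit -/

/-- **The parent leaf ⇒ V2264** (specialisation: drop the two bounds; the converse is not claimed —
the parent is `BoxVanishing` in ALL dimensions). [cite: KontsevichZagier2001, §1.2 Conjecture 1] -/
theorem stub_boxRigidity_var2264_of_parent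
    (h : ∀ (m m' : ℕ) (N : IntegralRep m) (N' : IntegralRep m'), N.domain = {x | ∀ i, x i ∈ Set.Ioo (0:ℝ) 1} → N.IsRational → N'.domain = {x | ∀ i, x i ∈ Set.Ioo (0:ℝ) 1} → N'.IsRational → N.value = N'.value → Equivalent N N') :
    ∀ (m m' : ℕ) (N : IntegralRep m) (N' : IntegralRep m'), m' ≤ 8 → m ≤ 3 → N.domain = {x | ∀ i, x i ∈ Set.Ioo (0:ℝ) 1} → N.IsRational → N'.domain = {x | ∀ i, x i ∈ Set.Ioo (0:ℝ) 1} → N'.IsRational → N.value = N'.value → Equivalent N N' :=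
  fun m m' N N' _ _ => h m m' N N'

/-- **`KontsevichZagierPeriods ⇒ V2264`**: the variant is a special case of Conjecture 1 for the tree's
calculus (`leaves_of_statement`) — so a refutation of the variant would refute the Summit.
[cite: KontsevichZagier2001, §1.2 Conjecture 1] -/
theorem stub_boxRigidity_var2264_of_statement (h : _root_.KontsevichZagierPeriods) :
    ∀ (m m' : ℕ) (N : IntegralRep m) (N' : IntegralRep m'), m' ≤ 8 → m ≤ 3 → N.domain = {x | ∀ i, x i ∈ Set.Ioo (0:ℝ) 1} → N.IsRational → N'.domain = {x | ∀ i, x i ∈ Set.Ioo (0:ℝ) 1} → N'.IsRational → N.value = N'.value → Equivalent N N' :=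
  stub_boxRigidity_var2264_of_parent (leaves_of_statement h).1

end Summit.KontsevichZagierPeriods.KontsevichZagierPeriods.Theorems

end
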